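import Literature.Geometry.Riemannian.RicciFlowSpatialRicciBounds
import Literature.Analysis.Calculus.DerivativeInterpolation
import Mathlib.Analysis.SpecialFunctions.Pow.Real
import HarnessLib

/-!
# Landau interpolation with componentwise second derivatives, and the rate bookkeeping
(helper file 8 for stub `stub_smoothRoundLimit`, line `margerin-cone-hamilton-rails`, crux
`EntropyRung.ChangGurskyYang`, item stmt-SmoothPoincare4-10834)

Pure analysis on a finite-dimensional real normed space `E` with a basis `b` (no geometry). The
device by which a DECAYING sup bound of order zero and a SLOWLY GROWING bound of order two give a
decaying bound of order one (Landau 1913; Hamilton 1982, §12 uses the integral version, here the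
pointwise one along a chart ball suffices):

* `one_add_log_ratio_sq_le` — `(1 + log((T−t₀)/(T−t)))² ≤ (1 + 1/ε)² (T−t₀)^{2ε} (T−t)^{−2ε}`
  (`log u ≤ u^ε/ε`): logarithmic growth is slower than every power;
* `pd_pd_eq_fderiv_fderiv`, `norm_fderiv_fderiv_le_pd` — the operator norm of the second Fréchet
  derivative against the iterated partial derivatives `∂_p ∂_q φ` along the basis;
* `norm_fderiv_le_of_pd_pd_le` — **Landau's inequality on a ball**, with the second-order bound
  in components: `‖Dφ(y)‖ ≤ 2M₀/s + s C_b² n² M₂` for `0 < s < r`;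
* `le_mul_rpow_of_interp` — the bookkeeping: if `X ≤ 2 D h^θ/s + s B h^{−θ/4}` for all
  `0 < s < r'`, then `X ≤ K h^{θ/4}` with `K` explicit in `D, B, r', θ` and an upper bound `h₀`
  of `h` (choose `s = h^{θ/2}` or `s = r'/2`).

## References

* E. Landau, *Einige Ungleichungen für zweimal differentiierbare Funktionen*, Proc. LMS 13
  (1913), 43–49.
* R. S. Hamilton, *Three-manifolds with positive Ricci curvature*, J. Differential Geom. 17
  (1982) 255–306, §12 (interpolation inequalities), §17. [Hamilton1982]
-/

noncomputable section

-- every `Summit.SmoothPoincare4.SmoothPoincare4.…` name repeats the summit = sub-problem segment (D-0017 layout)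
set_option linter.dupNamespace false

-- operator spaces of iterated derivatives
set_option maxSynthPendingDepth 3

open Set Function Filter Real Module Metric
open scoped Topology ContDiff

namespace Summit.SmoothPoincare4.SmoothPoincare4.Theorems.MargerinRails

open Literature.Geometry.Lorentzian Literature.Geometry.Lorentzian.MetricCoord
open Literature.Geometry.Riemannian (coordSum coordSum_nonneg)

universe u

/-! ### Logarithms against powers -/

section Log

/-- **`1 + log((T−t₀)/(T−t)) ≤ (1 + 1/ε) ((T−t₀)/(T−t))^ε`** for `t₀ ≤ t < T` and `ε > 0`
(`log u ≤ u^ε/ε`, Mathlib's `Real.log_le_rpow_div`, and `1 ≤ u^ε`). [folklore] -/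
theorem one_add_log_ratio_le {T t₀ t ε : ℝ} (ht : t ∈ Ico t₀ T) (hε : 0 < ε) :
    1 + Real.log ((T - t₀) / (T - t)) ≤ (1 + 1 / ε) * ((T - t₀) / (T - t)) ^ ε := by
  have hTt : 0 < T - t := sub_pos.2 ht.2
  have hu : 1 ≤ (T - t₀) / (T - t) := by rw [le_div_iff₀ hTt]; linarith [ht.1]
  have hu0 : 0 ≤ (T - t₀) / (T - t) := zero_le_one.trans hu
  have h1 := Real.log_le_rpow_div hu0 hε
  have h2 : 1 ≤ ((T - t₀) / (T - t)) ^ ε := Real.one_le_rpow hu hε.le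
  calc 1 + Real.log ((T - t₀) / (T - t)) ≤ ((T - t₀) / (T - t)) ^ ε + ((T - t₀) / (T - t)) ^ ε / ε :=
        add_le_add h2 h1
    _ = (1 + 1 / ε) * ((T - t₀) / (T - t)) ^ ε := by ring

/-- **`(1 + log((T−t₀)/(T−t)))² ≤ (1 + 1/ε)² (T−t₀)^{2ε} (T−t)^{−2ε}`**: logarithmic growth is
slower than every power. [folklore] -/
theorem one_add_log_ratio_sq_le {T t₀ t ε : ℝ} (ht : t ∈ Ico t₀ T) (hε : 0 < ε) :
    (1 + Real.log ((T - t₀) / (T - t))) ^ 2 ≤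
      (1 + 1 / ε) ^ 2 * (T - t₀) ^ (2 * ε) * (T - t) ^ (-(2 * ε)) := by
  have hTt : 0 < T - t := sub_pos.2 ht.2
  have hT₀ : 0 ≤ T - t₀ := by linarith [ht.1, ht.2]
  have hlog0 : 0 ≤ Real.log ((T - t₀) / (T - t)) :=
    Real.log_nonneg (by rw [le_div_iff₀ hTt]; linarith [ht.1])
  have h1 := one_add_log_ratio_le ht hε
  have h0 : 0 ≤ 1 + Real.log ((T - t₀) / (T - t)) := by linarith
  have hsq := pow_le_pow_left₀ h0 h1 2
  refine hsq.trans (le_of_eq ?_)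
  have hpow : (((T - t₀) / (T - t)) ^ ε) ^ 2 = (T - t₀) ^ (2 * ε) * (T - t) ^ (-(2 * ε)) := by
    rw [← Real.rpow_natCast (((T - t₀) / (T - t)) ^ ε) 2, ← Real.rpow_mul (div_nonneg hT₀ hTt.le),
      Real.div_rpow hT₀ hTt.le, Real.rpow_neg hTt.le, div_eq_mul_inv]
    push_cast
    ring_nf
  rw [mul_pow, hpow]
  ring

end Log

/-! ### Landau's inequality with componentwise second derivatives -/

section Landau

variable {E : Type u} [NormedAddCommGroup E] [NormedSpace ℝ E] [FiniteDimensional ℝ E]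
  {ι : Type*} [Fintype ι] (b : Basis ι ℝ E)

omit [FiniteDimensional ℝ E] [Fintype ι] in
/-- **Iterated partial derivatives are entries of the second Fréchet derivative**:
`∂_p ∂_q φ (y) = D²φ(y)(b_p)(b_q)` where `Dφ` is differentiable (`fderiv_clm_apply`).
[folklore] -/
theorem pd_pd_eq_fderiv_fderiv (φ : E → ℝ) {y : E} (h : DifferentiableAt ℝ (fderiv ℝ φ) y) (p q : ι) :
    pd b p (pd b q φ) y = fderiv ℝ (fderiv ℝ φ) y (b p) (b q) := by
  have hfun : pd b q φ = fun z ↦ fderiv ℝ φ z (b q) := rfl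
  rw [pd_apply, hfun, fderiv_clm_apply h (differentiableAt_const _)]
  simp

/-- **The operator norm of `D²φ(y)` against the iterated partials**:
`‖D²φ(y)‖ ≤ C_b² Σ_{p q} |∂_p ∂_q φ(y)|` (`norm_bilin_le_basis_sum`). [folklore] -/
theorem norm_fderiv_fderiv_le_pd (φ : E → ℝ) {y : E} (h : DifferentiableAt ℝ (fderiv ℝ φ) y) :
    ‖fderiv ℝ (fderiv ℝ φ) y‖ ≤ coordSum b ^ 2 * ∑ p, ∑ q, |pd b p (pd b q φ) y| := by
  have h1 := norm_bilin_le_basis_sum b (fderiv ℝ (fderiv ℝ φ) y)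
  refine h1.trans (le_of_eq ?_)
  congr 1
  refine Finset.sum_congr rfl fun p _ ↦ Finset.sum_congr rfl fun q _ ↦ ?_
  rw [Real.norm_eq_abs, pd_pd_eq_fderiv_fderiv b φ h]

omit [FiniteDimensional ℝ E] [Fintype ι] in
/-- A partial derivative is controlled by the operator norm of the derivative:
`|∂_q φ(y)| ≤ ‖Dφ(y)‖ ‖b_q‖`. [folklore] -/
theorem abs_pd_le_norm_fderiv (φ : E → ℝ) (y : E) (q : ι) : |pd b q φ y| ≤ ‖fderiv ℝ φ y‖ * ‖b q‖ := by
  rw [pd_apply, ← Real.norm_eq_abs]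
  exact (fderiv ℝ φ y).le_opNorm (b q)

/-- **Landau's inequality on a ball, with the second-order bound in components.** Let `φ` be
`C^∞` on an open `U ⊇ ball y r`, `|φ| ≤ M₀` on the ball and `|∂_p ∂_q φ| ≤ M₂` on the ball for all
`p, q`. Then `‖Dφ(y)‖ ≤ 2M₀/s + s C_b² n² M₂` for every `0 < s < r` (`M₂' = C_b² n² M₂` bounds
`‖D²φ‖` on the ball by `norm_fderiv_fderiv_le_pd`, hence `Dφ` is `M₂'`-Lipschitz there by the mean
value inequality, and Literature's `norm_fderiv_le_of_norm_le_of_lipschitz` applies).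
[cite: Hamilton1982, §12] -/
theorem norm_fderiv_le_of_pd_pd_le {U : Set E} (hU : IsOpen U) {φ : E → ℝ} (hφ : ContDiffOn ℝ ∞ φ U)
    {y : E} {r : ℝ} (hball : ball y r ⊆ U) {M₀ M₂ : ℝ} (hM₂ : 0 ≤ M₂)
    (h0 : ∀ y' ∈ ball y r, |φ y'| ≤ M₀) (h2 : ∀ y' ∈ ball y r, ∀ p q : ι, |pd b p (pd b q φ) y'| ≤ M₂)
    {s : ℝ} (hs : 0 < s) (hsr : s < r) :
    ‖fderiv ℝ φ y‖ ≤ 2 * M₀ / s + s * (coordSum b ^ 2 * Fintype.card ι ^ 2 * M₂) := by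
  -- differentiability on the ball
  have hcd : ∀ y' ∈ ball y r, ContDiffAt ℝ ∞ φ y' := fun y' hy' ↦ hφ.contDiffAt (hU.mem_nhds (hball hy'))
  have hd1 : ∀ y' ∈ ball y r, DifferentiableAt ℝ φ y' := fun y' hy' ↦ (hcd y' hy').differentiableAt (by simp)
  have hd2 : ∀ y' ∈ ball y r, DifferentiableAt ℝ (fderiv ℝ φ) y' := fun y' hy' ↦
    ((hcd y' hy').fderiv_right (m := ∞) (by simp)).differentiableAt (by simp)
  -- the operator bound of `D²φ` on the ball
  set M₂' : ℝ := coordSum b ^ 2 * Fintype.card ι ^ 2 * M₂ with hM₂'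
  have hM₂'nn : 0 ≤ M₂' := by positivity
  have hD2 : ∀ y' ∈ ball y r, ‖fderiv ℝ (fderiv ℝ φ) y'‖ ≤ M₂' := by
    intro y' hy'
    refine (norm_fderiv_fderiv_le_pd b φ (hd2 y' hy')).trans ?_
    rw [hM₂', mul_assoc]
    refine mul_le_mul_of_nonneg_left ?_ (pow_nonneg (coordSum_nonneg b) 2)
    calc ∑ p, ∑ q, |pd b p (pd b q φ) y'| ≤ ∑ _p : ι, ∑ _q : ι, M₂ :=
          Finset.sum_le_sum fun p _ ↦ Finset.sum_le_sum fun q _ ↦ h2 y' hy' p q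
      _ = Fintype.card ι ^ 2 * M₂ := by
          rw [Finset.sum_const, Finset.sum_const, Finset.card_univ, nsmul_eq_mul, nsmul_eq_mul]; ring
  -- `Dφ` is `M₂'`-Lipschitz on the ball
  have hlip : ∀ y' ∈ ball y r, ‖fderiv ℝ φ y' - fderiv ℝ φ y‖ ≤ M₂' * ‖y' - y‖ := fun y' hy' ↦
    (convex_ball y r).norm_image_sub_le_of_norm_fderiv_le (fun z hz ↦ hd2 z hz) hD2
      (mem_ball_self (hs.trans hsr)) hy'
  exact Literature.Analysis.Calculus.norm_fderiv_le_of_norm_le_of_lipschitz hd1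
    (fun y' hy' ↦ by rw [Real.norm_eq_abs]; exact h0 y' hy') hM₂'nn hlip hs hsr

end Landau

/-! ### The rate bookkeeping -/

section Rate

/-- **From `X ≤ 2 D h^θ/s + s B h^{−θ/4}` for all `0 < s < r'` to `X ≤ K h^{θ/4}`**, for
`0 < h ≤ h₀`: take `s = h^{θ/2}` when `h^{θ/2} ≤ r'/2` and `s = r'/2` otherwise (then `h` is
bounded below and everything is a constant). The constant `K` is explicit. [folklore] -/
theorem le_mul_rpow_of_interp {θ r' h h₀ D B X : ℝ} (hθ : 0 < θ) (hr' : 0 < r') (hh : 0 < h)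
    (hh₀ : h ≤ h₀) (hD : 0 ≤ D) (hB : 0 ≤ B)
    (hX : ∀ s : ℝ, 0 < s → s < r' → X ≤ 2 * (D * h ^ θ) / s + s * (B * h ^ (-(θ / 4)))) :
    X ≤ (2 * D * h₀ ^ (θ / 4) + B +
        (4 * D * h₀ ^ θ / r' + r' / 2 * B * (r' / 2) ^ (-(1 / 2 : ℝ))) * (r' / 2) ^ (-(1 / 2 : ℝ))) *
      h ^ (θ / 4) := by
  have hh₀pos : 0 < h₀ := hh.trans_le hh₀
  have hq : 0 < h ^ (θ / 4) := rpow_pos_of_pos hh _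
  have hhalf : 0 < r' / 2 := by positivity
  have hA : 0 ≤ 2 * D * h₀ ^ (θ / 4) + B := by positivity
  have hQ : 0 ≤ 4 * D * h₀ ^ θ / r' + r' / 2 * B * (r' / 2) ^ (-(1 / 2 : ℝ)) := by positivity
  have hQ' : 0 ≤ (4 * D * h₀ ^ θ / r' + r' / 2 * B * (r' / 2) ^ (-(1 / 2 : ℝ))) * (r' / 2) ^ (-(1 / 2 : ℝ)) :=
    by positivity
  -- algebra of the powers of `h`
  have hsplit : h ^ (θ / 2) = h ^ (θ / 4) * h ^ (θ / 4) := by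
    rw [← rpow_add hh]; ring_nf
  have hθsplit : h ^ θ = h ^ (θ / 2) * h ^ (θ / 2) := by
    rw [← rpow_add hh]; ring_nf
  by_cases hcase : h ^ (θ / 2) ≤ r' / 2
  · -- `s = h^{θ/2}`
    have hs : 0 < h ^ (θ / 2) := rpow_pos_of_pos hh _
    have h1 := hX (h ^ (θ / 2)) hs (hcase.trans_lt (by linarith))
    have hval : 2 * (D * h ^ θ) / h ^ (θ / 2) + h ^ (θ / 2) * (B * h ^ (-(θ / 4))) =
        (2 * D * h ^ (θ / 4) + B) * h ^ (θ / 4) := by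
      have hq2 : h ^ (θ / 2) = (h ^ (θ / 4)) ^ 2 := by rw [hsplit]; ring
      have hq4 : h ^ θ = (h ^ (θ / 4)) ^ 4 := by rw [hθsplit, hsplit]; ring
      have hqinv : h ^ (-(θ / 4)) = (h ^ (θ / 4))⁻¹ := rpow_neg hh.le _
      rw [hq2, hq4, hqinv]
      field_simp
    rw [hval] at h1
    have hmono : 2 * D * h ^ (θ / 4) + B ≤ 2 * D * h₀ ^ (θ / 4) + B := by
      have := rpow_le_rpow hh.le hh₀ (by positivity : 0 ≤ θ / 4)
      nlinarith
    calc X ≤ (2 * D * h ^ (θ / 4) + B) * h ^ (θ / 4) := h1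
      _ ≤ (2 * D * h₀ ^ (θ / 4) + B) * h ^ (θ / 4) := mul_le_mul_of_nonneg_right hmono hq.le
      _ ≤ _ := by
          refine mul_le_mul_of_nonneg_right ?_ hq.le
          linarith
  · -- `s = r'/2`
    push Not at hcase
    have h1 := hX (r' / 2) hhalf (by linarith)
    -- `h^θ ≤ h₀^θ`, `h^{-θ/4} ≤ (r'/2)^{-1/2}`, `1 ≤ (r'/2)^{-1/2} h^{θ/4}`
    have hθle : h ^ θ ≤ h₀ ^ θ := rpow_le_rpow hh.le hh₀ hθ.le
    have hpow1 : h ^ (-(θ / 4)) = (h ^ (θ / 2)) ^ (-(1 / 2 : ℝ)) := by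
      rw [← rpow_mul hh.le]; ring_nf
    have hpow2 : h ^ (θ / 4) = (h ^ (θ / 2)) ^ ((1 / 2 : ℝ)) := by
      rw [← rpow_mul hh.le]; ring_nf
    have hneg : h ^ (-(θ / 4)) ≤ (r' / 2) ^ (-(1 / 2 : ℝ)) := by
      rw [hpow1]
      exact rpow_le_rpow_of_nonpos hhalf hcase.le (by norm_num)
    have hone : 1 ≤ (r' / 2) ^ (-(1 / 2 : ℝ)) * h ^ (θ / 4) := by
      rw [hpow2]
      have h3 : (r' / 2) ^ ((1 / 2 : ℝ)) ≤ (h ^ (θ / 2)) ^ ((1 / 2 : ℝ)) :=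
        rpow_le_rpow hhalf.le hcase.le (by norm_num)
      have h4 : (r' / 2) ^ (-(1 / 2 : ℝ)) * (r' / 2) ^ ((1 / 2 : ℝ)) = 1 := by
        rw [← rpow_add hhalf]; norm_num
      calc (1 : ℝ) = (r' / 2) ^ (-(1 / 2 : ℝ)) * (r' / 2) ^ ((1 / 2 : ℝ)) := h4.symm
        _ ≤ (r' / 2) ^ (-(1 / 2 : ℝ)) * (h ^ (θ / 2)) ^ ((1 / 2 : ℝ)) :=
            mul_le_mul_of_nonneg_left h3 (rpow_nonneg hhalf.le _)
    have h2 : X ≤ 4 * D * h₀ ^ θ / r' + r' / 2 * B * (r' / 2) ^ (-(1 / 2 : ℝ)) := by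
      refine h1.trans ?_
      have e1 : 2 * (D * h ^ θ) / (r' / 2) ≤ 4 * D * h₀ ^ θ / r' := by
        rw [show 2 * (D * h ^ θ) / (r' / 2) = 4 * D * h ^ θ / r' by field_simp; ring]
        exact div_le_div_of_nonneg_right (by nlinarith) hr'.le
      have e2 : r' / 2 * (B * h ^ (-(θ / 4))) ≤ r' / 2 * B * (r' / 2) ^ (-(1 / 2 : ℝ)) := by
        rw [mul_assoc]
        exact mul_le_mul_of_nonneg_left (mul_le_mul_of_nonneg_left hneg hB) hhalf.le
      linarith
    calc X ≤ (4 * D * h₀ ^ θ / r' + r' / 2 * B * (r' / 2) ^ (-(1 / 2 : ℝ))) * 1 := by rw [mul_one]; exact h2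
      _ ≤ (4 * D * h₀ ^ θ / r' + r' / 2 * B * (r' / 2) ^ (-(1 / 2 : ℝ))) *
            ((r' / 2) ^ (-(1 / 2 : ℝ)) * h ^ (θ / 4)) := mul_le_mul_of_nonneg_left hone hQ
      _ = (4 * D * h₀ ^ θ / r' + r' / 2 * B * (r' / 2) ^ (-(1 / 2 : ℝ))) * (r' / 2) ^ (-(1 / 2 : ℝ)) *
            h ^ (θ / 4) := by ring
      _ ≤ _ := by
          refine mul_le_mul_of_nonneg_right ?_ hq.le
          linarith

/-- **HELPER `helper_interp_rate`** — the registered form of `le_mul_rpow_of_interp` (the rate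
bookkeeping of Landau interpolation between a decaying order-zero bound and a slowly growing
order-two bound). [cite: Hamilton1982, §12] -/
theorem helper_interp_rate : ∀ {θ r' h h₀ D B X : ℝ}, 0 < θ → 0 < r' → 0 < h → h ≤ h₀ → 0 ≤ D → 0 ≤ B → (∀ s : ℝ, 0 < s → s < r' → X ≤ 2 * (D * h ^ θ) / s + s * (B * h ^ (-(θ / 4)))) → X ≤ (2 * D * h₀ ^ (θ / 4) + B + (4 * D * h₀ ^ θ / r' + r' / 2 * B * (r' / 2) ^ (-(1 / 2 : ℝ))) * (r' / 2) ^ (-(1 / 2 : ℝ))) * h ^ (θ / 4) := by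
  intro θ r' h h₀ D B X hθ hr' hh hh₀ hD hB hX
  exact le_mul_rpow_of_interp hθ hr' hh hh₀ hD hB hX

end Rate

end Summit.SmoothPoincare4.SmoothPoincare4.Theorems.MargerinRails

end
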